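import Mathlib.MeasureTheory.Measure.Lebesgue.Basic
import Mathlib.MeasureTheory.Integral.Bochner.Set
import Literature.NumberTheory.UniformDistribution.EquidistributedModOnePi
import HarnessLib

/-!
# Uniform distribution mod 1 in `ℝ^s`: continuous test functions on the closed unit cube

Topic `Literature/NumberTheory/UniformDistribution` (part of the definition request
`defn-EquidistributedModOne`). Everything here is PROVED.

Source: L. Kuipers, H. Niederreiter, *Uniform distribution of sequences* (Wiley 1974), Ch. 1 §6,
Theorem 6.1 (p. 48) [KuipersNiederreiter1974]: a sequence `x` is u.d. mod 1 in `ℝ^s` iff for every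
continuous complex-valued `f` on the closed unit cube `Ī^s`,
`(1/N) Σ_{n ≤ N} f({x n}) → ∫_{Ī^s} f(x) dx`.

* `tendsto_riemannSum_setIntegral` — for `g` real-valued and continuous on `[0,1]^ι`, the Riemann
  sums `K^{-#ι} Σ_{j ∈ {0,…,K-1}^ι} g(j/K)` tend to `∫_{[0,1]^ι} g` (Lebesgue integral, `volume`).
* `EquidistributedModOnePi.tendsto_fractAvgPi` — **Theorem 6.1 (⇒)**, real-valued `g`:
  `(1/N) Σ_{n<N} g({x n}) → ∫_{[0,1]^ι} g`; complex-valued version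
  `EquidistributedModOnePi.tendsto_avg_complex`.
* `equidistributedModOnePi_iff_tendsto_fractAvgPi` — **Theorem 6.1** as an equivalence (⇐ through
  Weyl's criterion: the characters are continuous on the cube and have integral `0`).

The mechanism (`EquidistributedModOnePi.tendsto_fractAvgPi_of_riemannSum`: boxes ⇒ Riemann sums) is
in `EquidistributedModOnePi.lean`; this file supplies the identification of the limit of the
Riemann sums with the integral (uniform continuity and the decomposition of `[0,1)^ι` into the
`K^{#ι}` grid cells).

## References

* [KuipersNiederreiter1974] L. Kuipers, H. Niederreiter, *Uniform distribution of sequences*, Wiley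
  1974, Ch. 1 §6, Theorem 6.1 (p. 48).
-/

noncomputable section

open Filter Topology Asymptotics MeasureTheory Set

namespace Literature.NumberTheory.UniformDistribution

variable {ι : Type*} [Fintype ι]

/-- The half-open unit cube `[0,1)^ι` has Lebesgue measure `1`. [folklore] -/
theorem volume_real_cube : volume.real (Set.pi Set.univ fun _ : ι => Set.Ico (0 : ℝ) 1) = 1 := by
  rw [Measure.real, Real.volume_pi_Ico_toReal (fun _ => zero_le_one)]
  simp

/-- A grid cell `Π_i [j_i/K, (j_i+1)/K)` has Lebesgue measure `K^{-#ι}`. [folklore] -/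
theorem volume_real_cell {K : ℕ} (hK : 0 < K) (j : ι → ℕ) :
    volume.real (Set.pi Set.univ fun i => Set.Ico ((j i : ℝ) / K) (((j i : ℝ) + 1) / K)) =
      1 / (K : ℝ) ^ Fintype.card ι := by
  have hKr : (0 : ℝ) < K := Nat.cast_pos.2 hK
  rw [Measure.real, Real.volume_pi_Ico_toReal (fun i =>
    (div_le_div_of_nonneg_right (le_add_of_nonneg_right zero_le_one) hKr.le))]
  rw [Finset.prod_congr rfl fun i _ => show ((j i : ℝ) + 1) / K - (j i : ℝ) / K = 1 / K by ring,
    Finset.prod_const, Finset.card_univ, one_div_pow]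

/-- **Riemann sums over the uniform grids converge to the integral**: for `g` real-valued and
continuous on the closed cube `[0,1]^ι`,
`K^{-#ι} Σ_{j ∈ {0,…,K-1}^ι} g(j/K) → ∫_{[0,1]^ι} g` as `K → ∞`. [folklore] -/
theorem tendsto_riemannSum_setIntegral [DecidableEq ι] {g : (ι → ℝ) → ℝ}
    (hg : ContinuousOn g (Set.Icc 0 1)) :
    Tendsto (fun K : ℕ => (∑ j ∈ Fintype.piFinset fun _ : ι => Finset.range K,
        g (fun i => (j i : ℝ) / K)) / (K : ℝ) ^ Fintype.card ι)
      atTop (𝓝 (∫ y in Set.Icc (0 : ι → ℝ) 1, g y)) := by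
  rw [Metric.tendsto_atTop]
  intro ε hε
  have hε2 : 0 < ε / 2 := half_pos hε
  obtain ⟨δ, hδ, hUC⟩ := Metric.uniformContinuousOn_iff_le.1
    (isCompact_Icc.uniformContinuousOn_of_continuous hg) (ε / 2) hε2
  obtain ⟨K₀, hK₀⟩ := exists_nat_one_div_lt hδ
  refine ⟨K₀ + 1, fun K hKK₀ => ?_⟩
  have hK : 0 < K := by omega
  have hKr : (0 : ℝ) < K := Nat.cast_pos.2 hK
  have hKδ : 1 / (K : ℝ) ≤ δ := by
    refine le_trans ?_ hK₀.le
    gcongr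
    exact_mod_cast hKK₀
  -- notation
  set C₀ : Set (ι → ℝ) := Set.pi Set.univ fun _ : ι => Set.Ico (0 : ℝ) 1 with hC₀
  set J : Finset (ι → ℕ) := Fintype.piFinset fun _ : ι => Finset.range K with hJ
  set c : (ι → ℕ) → ℝ := fun j => g (fun i => (j i : ℝ) / K) with hc
  set cell : (ι → ℕ) → Set (ι → ℝ) := fun j =>
    Set.pi Set.univ fun i => Set.Ico ((j i : ℝ) / K) (((j i : ℝ) + 1) / K) with hcell
  set step : (ι → ℝ) → ℝ := fun y => ∑ j ∈ J, Set.indicator (cell j) (fun _ => c j) y with hstep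
  have hcell_meas : ∀ j, MeasurableSet (cell j) := fun j =>
    MeasurableSet.univ_pi fun i => measurableSet_Ico
  have hcell_sub : ∀ j ∈ J, cell j ⊆ C₀ := by
    intro j hj y hy i _
    have hjK : j i + 1 ≤ K := Finset.mem_range.1 ((Fintype.mem_piFinset.1 hj) i)
    have hyi := hy i (Set.mem_univ i)
    exact ⟨le_trans (by positivity) hyi.1,
      lt_of_lt_of_le hyi.2 ((div_le_one hKr).2 (by exact_mod_cast hjK))⟩
  -- the cell of a point of the cube
  have hmem_cell : ∀ y ∈ C₀, ∀ j : ι → ℕ, y ∈ cell j ↔ (fun i => ⌊(K : ℝ) * y i⌋₊) = j := by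
    intro y hy j
    simp only [hcell, Set.mem_pi, Set.mem_univ, true_imp_iff, funext_iff]
    refine forall_congr' fun i => ?_
    rw [Nat.floor_eq_iff (mul_nonneg hKr.le (hy i (Set.mem_univ i)).1), Set.mem_Ico,
      div_le_iff₀ hKr, lt_div_iff₀ hKr, mul_comm (y i)]
  have hfloor_mem : ∀ y ∈ C₀, (fun i => ⌊(K : ℝ) * y i⌋₊) ∈ J := by
    intro y hy
    simp only [hJ, Fintype.mem_piFinset, Finset.mem_range]
    intro i
    rw [Nat.floor_lt (mul_nonneg hKr.le (hy i (Set.mem_univ i)).1)]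
    calc (K : ℝ) * y i < K * 1 := mul_lt_mul_of_pos_left (hy i (Set.mem_univ i)).2 hKr
      _ = K := mul_one _
  have hstep_eq : ∀ y ∈ C₀, step y = c (fun i => ⌊(K : ℝ) * y i⌋₊) := by
    intro y hy
    rw [hstep]
    dsimp only
    rw [Finset.sum_eq_single_of_mem _ (hfloor_mem y hy)]
    · rw [Set.indicator_of_mem ((hmem_cell y hy _).2 rfl)]
    · intro j _ hne
      rw [Set.indicator_of_notMem]
      exact fun hmem => hne ((hmem_cell y hy _).1 hmem).symm
  -- uniform closeness on the half-open cube
  have hclose : ∀ y ∈ C₀, ‖g y - step y‖ ≤ ε / 2 := by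
    intro y hy
    rw [hstep_eq y hy, hc, Real.norm_eq_abs]
    dsimp only
    have hyI : y ∈ Set.Icc (0 : ι → ℝ) 1 :=
      ⟨fun i => (hy i (Set.mem_univ i)).1, fun i => (hy i (Set.mem_univ i)).2.le⟩
    have h1 : ∀ i, ((⌊(K : ℝ) * y i⌋₊ : ℝ)) / K ≤ y i := fun i => by
      rw [div_le_iff₀ hKr, mul_comm (y i)]
      exact Nat.floor_le (mul_nonneg hKr.le (hy i (Set.mem_univ i)).1)
    have h2 : ∀ i, y i < ((⌊(K : ℝ) * y i⌋₊ : ℝ) + 1) / K := fun i => by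
      rw [lt_div_iff₀ hKr, mul_comm (y i)]
      exact Nat.lt_floor_add_one _
    have hzI : (fun i => ((⌊(K : ℝ) * y i⌋₊ : ℝ)) / K) ∈ Set.Icc (0 : ι → ℝ) 1 :=
      ⟨fun i => by positivity, fun i => (h1 i).trans (hy i (Set.mem_univ i)).2.le⟩
    have hdist : dist y (fun i => ((⌊(K : ℝ) * y i⌋₊ : ℝ)) / K) ≤ δ := by
      refine (dist_pi_le_iff hδ.le).2 fun i => ?_
      rw [Real.dist_eq, abs_of_nonneg (by linarith [h1 i])]
      have : ((⌊(K : ℝ) * y i⌋₊ : ℝ) + 1) / K = (⌊(K : ℝ) * y i⌋₊ : ℝ) / K + 1 / K := by ring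
      linarith [h2 i]
    have := hUC y hyI _ hzI hdist
    rwa [Real.dist_eq] at this
  -- integral of the step function over the half-open cube = the Riemann sum
  have hC₀fin : volume C₀ < ⊤ := by
    rw [hC₀, Real.volume_pi_Ico]
    exact ENNReal.prod_lt_top fun i _ => ENNReal.ofReal_lt_top
  have hint_cell : ∀ j ∈ J, ∫ y in C₀, Set.indicator (cell j) (fun _ => c j) y = c j * (1 / (K : ℝ) ^ Fintype.card ι) := by
    intro j hj
    rw [setIntegral_indicator (hcell_meas j), Set.inter_eq_right.2 (hcell_sub j hj), setIntegral_const,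
      smul_eq_mul, volume_real_cell hK j, mul_comm]
  have hstep_int : ∀ j ∈ J, IntegrableOn (Set.indicator (cell j) fun _ => c j) C₀ volume := by
    intro j _
    exact (integrableOn_const (hs := hC₀fin.ne)).indicator (hcell_meas j)
  have hI_step : ∫ y in C₀, step y = (∑ j ∈ J, c j) / (K : ℝ) ^ Fintype.card ι := by
    rw [hstep]
    dsimp only
    rw [integral_finsetSum _ hstep_int, Finset.sum_congr rfl hint_cell, ← Finset.sum_mul, mul_one_div]
  -- integral of `g` over the closed cube = over the half-open cube
  have hgI : IntegrableOn g (Set.Icc (0 : ι → ℝ) 1) volume := hg.integrableOn_compact isCompact_Icc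
  have hC₀sub : C₀ ⊆ Set.Icc (0 : ι → ℝ) 1 := fun y hy =>
    ⟨fun i => (hy i (Set.mem_univ i)).1, fun i => (hy i (Set.mem_univ i)).2.le⟩
  have hI_g : ∫ y in Set.Icc (0 : ι → ℝ) 1, g y = ∫ y in C₀, g y := by
    refine (setIntegral_congr_set ?_).symm
    rw [hC₀]
    exact Measure.univ_pi_Ico_ae_eq_Icc
  -- the estimate
  have hsub_int : ∫ y in C₀, (g y - step y) = (∫ y in C₀, g y) - ∫ y in C₀, step y :=
    integral_sub (hgI.mono_set hC₀sub) (integrable_finsetSum J hstep_int)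
  have hb := norm_setIntegral_le_of_norm_le_const hC₀fin hclose
  rw [volume_real_cube, mul_one, Real.norm_eq_abs, hsub_int] at hb
  have hRS : (∑ j ∈ J, c j) / (K : ℝ) ^ Fintype.card ι = ∫ y in C₀, step y := hI_step.symm
  rw [Real.dist_eq, hI_g]
  calc |(∑ j ∈ J, c j) / (K : ℝ) ^ Fintype.card ι - ∫ y in C₀, g y|
      = |(∫ y in C₀, g y) - ∫ y in C₀, step y| := by rw [hRS, abs_sub_comm]
    _ ≤ ε / 2 := hb
    _ < ε := by linarith

/-- **K–N Theorem 6.1 (⇒), real-valued test functions.** If `x` is u.d. mod 1 in `ℝ^ι` then for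
every real-valued `g` continuous on the closed cube `[0,1]^ι`,
`(1/N) Σ_{n<N} g({x n}) → ∫_{[0,1]^ι} g`. [cite: KuipersNiederreiter1974, Ch. 1, Theorem 6.1] -/
theorem EquidistributedModOnePi.tendsto_fractAvgPi {x : ℕ → ι → ℝ} (hx : EquidistributedModOnePi x)
    {g : (ι → ℝ) → ℝ} (hg : ContinuousOn g (Set.Icc 0 1)) :
    Tendsto (fun N => fractAvgPi x N g) atTop (𝓝 (∫ y in Set.Icc (0 : ι → ℝ) 1, g y)) := by
  classical
  refine hx.tendsto_fractAvgPi_of_riemannSum hg fun ε hε => ?_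
  have h := Metric.tendsto_atTop.1 (tendsto_riemannSum_setIntegral hg) ε hε
  obtain ⟨K₀, hK₀⟩ := h
  filter_upwards [eventually_ge_atTop K₀] with K hK
  have := hK₀ K hK
  rw [Real.dist_eq] at this
  exact this.le

/-- **K–N Theorem 6.1 (⇒), complex-valued test functions**: for `f : ℝ^ι → ℂ` continuous on the
closed cube `[0,1]^ι`, `(1/N) Σ_{n<N} f({x n}) → ∫_{[0,1]^ι} f`. [cite: KuipersNiederreiter1974, Ch. 1, Theorem 6.1] -/
theorem EquidistributedModOnePi.tendsto_avg_complex {x : ℕ → ι → ℝ} (hx : EquidistributedModOnePi x)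
    {f : (ι → ℝ) → ℂ} (hf : ContinuousOn f (Set.Icc 0 1)) :
    Tendsto (fun N : ℕ => (∑ n ∈ Finset.range N, f (fun i => Int.fract (x n i))) / (N : ℂ)) atTop
      (𝓝 (∫ y in Set.Icc (0 : ι → ℝ) 1, f y)) := by
  have hre := hx.tendsto_fractAvgPi (Complex.continuous_re.comp_continuousOn hf)
  have him := hx.tendsto_fractAvgPi (Complex.continuous_im.comp_continuousOn hf)
  have hfi : IntegrableOn f (Set.Icc (0 : ι → ℝ) 1) volume := hf.integrableOn_compact isCompact_Icc
  have h1 : ∫ y in Set.Icc (0 : ι → ℝ) 1, (f y).re = (∫ y in Set.Icc (0 : ι → ℝ) 1, f y).re := by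
    simpa using integral_re hfi
  have h2 : ∫ y in Set.Icc (0 : ι → ℝ) 1, (f y).im = (∫ y in Set.Icc (0 : ι → ℝ) 1, f y).im := by
    simpa using integral_im hfi
  have hlim : Tendsto (fun N : ℕ => ((fractAvgPi x N fun y => (f y).re : ℝ) : ℂ) +
      ((fractAvgPi x N fun y => (f y).im : ℝ) : ℂ) * Complex.I) atTop
      (𝓝 (((∫ y in Set.Icc (0 : ι → ℝ) 1, f y).re : ℂ) +
        ((∫ y in Set.Icc (0 : ι → ℝ) 1, f y).im : ℂ) * Complex.I)) := by
    rw [← h1, ← h2]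
    exact ((Complex.continuous_ofReal.tendsto _).comp hre).add
      (((Complex.continuous_ofReal.tendsto _).comp him).mul_const Complex.I)
  rw [Complex.re_add_im] at hlim
  refine hlim.congr fun N => ?_
  apply Complex.ext
  · simp [fractAvgPi, Complex.re_sum]
  · simp [fractAvgPi, Complex.im_sum]

/-- `∫_{[0,1]^ι} e(⟨h, y⟩) dy = 0` for a lattice point `h ≠ 0` (limit of the vanishing Riemann sums).
[folklore] -/
theorem setIntegral_exp_two_pi_mul_sum_eq_zero {h : ι → ℤ} (hh : h ≠ 0) :
    ∫ y in Set.Icc (0 : ι → ℝ) 1,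
      Complex.exp (2 * Real.pi * Complex.I * ((∑ i, (h i : ℝ) * y i : ℝ) : ℂ)) = 0 := by
  classical
  set χ : (ι → ℝ) → ℂ := fun y =>
    Complex.exp (2 * Real.pi * Complex.I * ((∑ i, (h i : ℝ) * y i : ℝ) : ℂ)) with hχ
  have hχc : Continuous χ := by rw [hχ]; fun_prop
  have hRS : ∀ᶠ K : ℕ in atTop, ∑ j ∈ Fintype.piFinset (fun _ : ι => Finset.range K),
      χ (fun i => (j i : ℝ) / K) = 0 := by
    filter_upwards [eventually_gt_atTop (∑ i, (h i).natAbs)] with K hK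
    exact sum_piFinset_exp_eq_zero hh hK
  -- real and imaginary parts of the integral are limits of vanishing Riemann sums
  have hrec : Continuous fun y => (χ y).re := Complex.continuous_re.comp hχc
  have himc : Continuous fun y => (χ y).im := Complex.continuous_im.comp hχc
  have hre : ∫ y in Set.Icc (0 : ι → ℝ) 1, (χ y).re = 0 := by
    refine tendsto_nhds_unique (tendsto_riemannSum_setIntegral hrec.continuousOn) ?_
    refine tendsto_const_nhds.congr' ?_
    filter_upwards [hRS] with K hK
    rw [← Complex.re_sum, hK, Complex.zero_re, zero_div]
  have him : ∫ y in Set.Icc (0 : ι → ℝ) 1, (χ y).im = 0 := by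
    refine tendsto_nhds_unique (tendsto_riemannSum_setIntegral himc.continuousOn) ?_
    refine tendsto_const_nhds.congr' ?_
    filter_upwards [hRS] with K hK
    rw [← Complex.im_sum, hK, Complex.zero_im, zero_div]
  have hfi : IntegrableOn χ (Set.Icc (0 : ι → ℝ) 1) volume :=
    hχc.continuousOn.integrableOn_compact isCompact_Icc
  apply Complex.ext
  · rw [← RCLike.re_to_complex, ← integral_re hfi]
    simpa using hre
  · rw [← RCLike.im_to_complex, ← integral_im hfi]
    simpa using him

/-- **K–N Theorem 6.1 as an equivalence** (real-valued test functions): `x` is u.d. mod 1 in `ℝ^ι`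
iff `(1/N) Σ_{n<N} g({x n}) → ∫_{[0,1]^ι} g` for every real-valued `g` continuous on `[0,1]^ι`.
(⇐ through Weyl's criterion, with the real and imaginary parts of the characters.)
[cite: KuipersNiederreiter1974, Ch. 1, Theorem 6.1] -/
theorem equidistributedModOnePi_iff_tendsto_fractAvgPi (x : ℕ → ι → ℝ) :
    EquidistributedModOnePi x ↔ ∀ g : (ι → ℝ) → ℝ, ContinuousOn g (Set.Icc 0 1) →
      Tendsto (fun N => fractAvgPi x N g) atTop (𝓝 (∫ y in Set.Icc (0 : ι → ℝ) 1, g y)) := by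
  refine ⟨fun hx g hg => hx.tendsto_fractAvgPi hg, fun H => ?_⟩
  refine equidistributedModOnePi_of_isLittleO_weylSumPi fun h hh => ?_
  set χ : (ι → ℝ) → ℂ := fun y =>
    Complex.exp (2 * Real.pi * Complex.I * ((∑ i, (h i : ℝ) * y i : ℝ) : ℂ)) with hχ
  have hχc : Continuous χ := by rw [hχ]; fun_prop
  have hre := H _ (Complex.continuous_re.comp hχc).continuousOn
  have him := H _ (Complex.continuous_im.comp hχc).continuousOn
  have hfi : IntegrableOn χ (Set.Icc (0 : ι → ℝ) 1) volume :=
    hχc.continuousOn.integrableOn_compact isCompact_Icc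
  have h0 := setIntegral_exp_two_pi_mul_sum_eq_zero hh (ι := ι)
  have h1 : ∫ y in Set.Icc (0 : ι → ℝ) 1, (χ y).re = 0 := by
    have := integral_re hfi
    simp only [RCLike.re_to_complex] at this
    rw [this, hχ]
    simp only [h0, Complex.zero_re]
  have h2 : ∫ y in Set.Icc (0 : ι → ℝ) 1, (χ y).im = 0 := by
    have := integral_im hfi
    simp only [RCLike.im_to_complex] at this
    rw [this, hχ]
    simp only [h0, Complex.zero_im]
  simp only [Function.comp_def] at hre him
  rw [h1] at hre
  rw [h2] at him
  have hlim : Tendsto (fun N : ℕ => ((fractAvgPi x N fun y => (χ y).re : ℝ) : ℂ) +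
      ((fractAvgPi x N fun y => (χ y).im : ℝ) : ℂ) * Complex.I) atTop (𝓝 ((0 : ℝ) + (0 : ℝ) * Complex.I)) :=
    ((Complex.continuous_ofReal.tendsto _).comp hre).add
      (((Complex.continuous_ofReal.tendsto _).comp him).mul_const Complex.I)
  simp only [Complex.ofReal_zero, zero_mul, add_zero] at hlim
  have h3 : (fun N : ℕ => ∑ n ∈ Finset.range N,
      Complex.exp (2 * Real.pi * Complex.I * ((∑ i, (h i : ℝ) * x n i : ℝ) : ℂ))) =o[atTop]
      fun N : ℕ => (N : ℂ) := by
    refine (Asymptotics.isLittleO_iff_tendsto' ?_).2 ?_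
    · filter_upwards [eventually_ne_atTop 0] with N hN hN0
      exact absurd (by exact_mod_cast hN0 : N = 0) hN
    · refine hlim.congr fun N => ?_
      rw [Finset.sum_congr rfl fun n _ => exp_two_pi_mul_sum_eq_fract h (x n)]
      apply Complex.ext
      · simp [fractAvgPi, Complex.re_sum, hχ]
      · simp [fractAvgPi, Complex.im_sum, hχ]
  exact h3.norm_right.congr_right fun N => Complex.norm_natCast N

end Literature.NumberTheory.UniformDistribution

end
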